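import Literature.MathematicalPhysics.QuantumFieldTheory.Balaban1983to89.Beta.RemainderDecay190

/-!
# Joint NON-VACUITY of the k-uniform remainder chain's hypothesis lists: an explicit inhabitant of every binder of
`RemainderDecay190.ChainTFac190.abs_beta1_le` and of `RemainderLocality.ChainTFac.abs_beta1_le` (hence of `ChainTLoc` /
`ChainT`) — `Beta.RemainderWitness`

HONEST FRAMING (cell rule, page 1 of everything).  Discharging `BetaPertH` makes Bałaban's UV stability UNCONDITIONAL —
a real constructive-QFT result; it is NOT the continuum limit and NOT the Clay problem.  This module discharges NOTHING
of `BetaPertH` and asserts NOTHING about Bałaban's objects.  It is a kernel CERTIFICATE OF CONSISTENCY of the an4 lane's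
END theorems (row BETA-an4, the k-uniform remainder): the current END
`RemainderDecay190.ChainTFac190.abs_beta1_le (R : ChainTFac190 d M μ ν S γ c ℓ α₂ q) (hC : CondsL d c ℓ)
(h22 : c.R22gen ℓ) (hq : q.Valid c.δ₀) (hs : SignsL c α₂ q.B₃) (hd : 0 < d) : RemainderConst S γ (c.ε₁ · K_rem,L)` and its
predecessor `RemainderLocality.ChainTFac.abs_beta1_le` quantify over HYPOTHESIS structures with some thirty fields each
(the exhausting tori, the [II]-side torus step data with the restriction property p. 15, the representation (2.13) and
Lemma 3's (2.38)_ℓ AT THE CONSTRUCTED TORUS GEOMETRY, the (3.32)/(4.4) seam, analyticity, (4.35), the p. 282 decay resp.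
the [15] (190) / [3] (2.61) data generating it, the (1.7)/(1.21) factorisation (F1) and the restricted test-configuration
limits (F2)) and over the numeric side conditions; were these jointly unsatisfiable the ENDs would be vacuous.  They are
not: §§1–3b construct closed terms for EVERY binder and §5 applies the END theorems to them BY NAME.

WHAT THE WITNESS TESTS AND WHAT IT DOES NOT.  (a) NUMERICS, for every dimension d: the explicit constants `c₀ d`
(δ = 1/20 and ℓ = 2, so that (1 − 10δ)ℓ = 1; κ := κ_thr(d, 2); A₂ := A₂_thr(d); C₃ = 162 from L = 1, A₁ = E₀ = 1,
K₀(c) = 1; ε₁ := ε₁_thr(d, κ)/162 > 0; δ₀ = 1) satisfy `CondsL d (c₀ d) 2`, `(c₀ d).R22gen 2`, `SignsL (c₀ d) 1 1`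
SIMULTANEOUSLY (`numeric_witness`, via the tree's `CondsL.of_thresholds`) — the four k-free conditions, the closing
relation and the signs are consistent, with a NON-ZERO activity constant C₃ε₁ > 0; and the (190)-constants `q₀` satisfy
`Consts190.Valid q₀ 1` with `q₀.B₃ = 1`.  (b) STRUCTURE: the ZERO-ACTIVITY torus step (all activities, potentials and
polarization terms 0, spaces = everything, Φ = Unit) on the exhausting tori N_n = n + 1 inhabits
`PolLeavesTFac d M 0 c ℓ α₂ B₃` for ANY c with 0 ≤ C₃ε₁ and any B₃ ≥ 0 (`zeroLeaves`), and — with a ONE-SITE multiscale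
geometry, `|·|` as block norm, first B-derivative 0 and ZERO unit source fields — `PolLeavesTFac190 d M 0 c ℓ α₂ q₀`
(`zeroLeaves190`): this tests the typing of the torus systems `tsys` / `TDom` / `LDom` / `tproj`, of the [II]-predicates
`SpRestr` / `Repr213` / `Bound238With` at the constructed geometry `TorusStep.geom` (for (2.13) one needs
`locE … 0 … = 0`: the X-localized part of the Kotecký–Preiss logarithm of the polymer gas with ZERO activities vanishes —
`polymerRayDeriv_zero`, `polymerLogZ_zero`, `truncatedWeight_zero`, `locE_zero`, §2), of the seam, of `mixedDeriv` at the
zero functional, of (F1)/(F2), and of the (190)-layer `Data190` (`BlockNorm`, `Ineq190` = `HasMaj`, `RowSum`,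
`NormDominated`, `UnitFieldsLocalised`) — at the trivial point.  It does NOT test the analytic CONTENT of any field (zero
activities make every estimate an instance of 0 ≤ RHS; `UnitFieldsLocalised` holds VACUOUSLY for zero source fields),
and the split witness has β¹ ≡ 0.  (c) (v1.1, §6) THE WALL-SIDE (R10) ENDs `betaPartialSumsLowerH_of_telescope_chainTFac190` /
`endpointExistence_of_telescope_chainTFac190` are applied TOO: their extra flow-side binders (forward generation,
telescoping `∑_{j<k} β⁰_j = B(L^k)`, `|B n − b·log n| ≤ A`, the budget `ε₁·K_rem,L ≤ b·log L`, `BetaContH`, `BetaUpperH`)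
are inhabited by the CONSTANT split β ≡ λ := ε₁·K_rem,L(d, M, c₀ d, 1, B₃(q₀)) itself (budget with EQUALITY, A = 0) and
the lead lineage's canonical construction `FlowStepRuns.modelOf β` — `wall_binders_inhabited`, `wallSums_applied`,
`wallEnd_applied : EndpointExistence (modelOf (β ≡ λ(d, M)))`; the statement-grade wall ENDs of
`AveragedAFCarrierScalewise` (A-R306 form and its [III] twin) are the β lead's `Beta.WallWitness`, not repeated here.
Every statement is [folklore]; no `Literature` fact is minted; no `axiom`, no `sorry`.

VERSIONS.  v1 = p185458 (§§1–5).  v1.1 = v1 with §6 APPENDED (the (R10) ENDs applied) and this header's item (c)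
rewritten accordingly; no declaration of v1 is changed or removed.  v1.2 = DOCSTRING-ONLY over v1.1: the p. 21
locators of the quoted context phrases corrected (*"for κ sufficiently large, and ε₁ sufficiently small"* prints after
(2.39), *"(1 − 10δ)½L = 1"* after (2.41); cell cross-read C-pv20-43 R-note 1) and the `lamW` docstring spells
out that the (R10) END's budget left-hand side is `lamW d M` by unfolding (+ one `rfl` example; C-pv20-44 R-note 2);
no declaration changed, none added.

CITATION HEADER (lean-in-tree rule).  T. Bałaban, *Renormalization group approach to lattice gauge field theories. II.
Cluster expansions*, Commun. Math. Phys. **116**, 1–22 (1988) [Balaban1988RG2Cluster] = [II], p. 21 — after (2.39):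
*"for κ sufficiently large, and ε₁ sufficiently small"*; after (2.41): *"(1 − 10δ)½L = 1"* — quoted and render-checked in
`…Balaban1983to89.B13` / `…Beta.RemainderChainLattice` (typed `CondsL`, `B13.Consts.R22gen`), Lemma 3 (2.38) p. 20
(typed `B13.Bound238With`), (2.13) p. 14 (typed `B13Resummation.Repr213`); T. Bałaban, *Renormalization group approach to
lattice gauge field theories. I.*, Commun. Math. Phys. **109**, 249–301 (1987) [Balaban1987RG1] = [I], (4.35) p. 290,
(5.1) p. 292, (1.22) p. 264, p. 282 — quoted in `…Beta.RemainderChainTorus` / `…B12Decay510`; T. Bałaban, *The variational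
problem and background fields in renormalization group method for lattice gauge theories*, Commun. Math. Phys. **102**,
277–309 (1985) = [15] [Balaban1985Variational], (190) p. 308 — quoted in `…B11SectG` / `…Beta.RemainderDecay190`.  Nothing is quoted afresh here and nothing of these papers is asserted.

ABSOLUTE RULE (cell).  "No internally-minted statement may enter as a cited fact. Every hypothesis is either
kernel-proved in this package or a verbatim quotation of a PUBLISHED theorem with page reference. The manuscript(s)
under audit are NOT citable for their own disputed steps — they are the thing under adjudication; programme-internal
(2001/route/tribunal) claims are never citable."  Nothing below is cited: the `[cite: …]` tags point at the printed
CONTEXT of the hypothesis shapes being inhabited ([Balaban1988RG2Cluster] = [II] p. 21: after (2.39) *"for κ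
sufficiently large, and ε₁ sufficiently small"*, after (2.41) *"(1 − 10δ)½L = 1"* — typed `CondsL` / `R22gen`;
[Balaban1987RG1] = [I] (4.35) p. 290, (5.1) p. 292), never at a proof.
-/

namespace Literature.MathematicalPhysics.QuantumFieldTheory.Balaban1983to89.Beta.RemainderWitness

open Literature.MathematicalPhysics.QuantumFieldTheory.Balaban1983to89
open FlowStep
open Literature.MathematicalPhysics.QuantumFieldTheory.Balaban1983to89.B13ScaleTransfer (Pt)
open Literature.MathematicalPhysics.QuantumFieldTheory.Balaban1983to89.B13Resummation (SpRestr Repr213 locE)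
open Literature.MathematicalPhysics.QuantumFieldTheory.Balaban1983to89.B12TreeDecay (kappa₀ K₀ K₀_pos)
open Literature.MathematicalPhysics.QuantumFieldTheory.Balaban1983to89.TreeLengthTorus (TPt TDom proj tsys)
open Literature.MathematicalPhysics.QuantumFieldTheory.Balaban1983to89.TreeLengthTorusGeometry (TorusStep TTouch)
open Literature.MathematicalPhysics.QuantumFieldTheory.Balaban1983to89.B12Decay510 (mixedDeriv)
open Literature.MathematicalPhysics.QuantumFieldTheory.Balaban1983to89.B12Decay510Torus (distCT nearT)
open Literature.MathematicalPhysics.QuantumFieldTheory.Balaban1983to89.Beta.RemainderChain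
open Literature.MathematicalPhysics.QuantumFieldTheory.Balaban1983to89.Beta.RemainderChainLattice
open Literature.MathematicalPhysics.QuantumFieldTheory.Balaban1983to89.Beta.RemainderChainTorus (ChainT)
open Literature.MathematicalPhysics.QuantumFieldTheory.Balaban1983to89.Beta.RemainderLimitTorus (LDom tproj limKernel ChainTLoc)
open Literature.MathematicalPhysics.QuantumFieldTheory.Balaban1983to89.Beta.RemainderLocality (PolLeavesTFac ChainTFac)
open Literature.MathematicalPhysics.QuantumFieldTheory.Balaban1983to89.Beta.RemainderDecay190
  (Consts190 Data190 PolLeavesTFac190 ChainTFac190)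
open Literature.MathematicalPhysics.QuantumFieldTheory.Balaban1983to89.B11SectG (BlockNorm)
open Literature.Probability.LatticeModels
open Filter Metric
open scoped _root_.Topology

noncomputable section

variable {d : ℕ}

/-! ## 1. The numeric witness: `CondsL`, the closing relation, the signs — for every dimension -/

/-- EXPLICIT CONSTANTS satisfying the four k-free conditions of the concrete carrier at ℓ = 2: δ = 1/20 (so
(1 − 10δ)·2 = 1), κ := the κ-threshold κ_thr(d, 2), A₂ := the A₂-threshold, L = 1, A₁ = E₀ = 1 and K₀(c) = 1 (C₁ = ½,
α₄ = α₆ = M = 1, q = 0, C₂ = 0) so that C₃ = 2·3⁴ = 162, ε₁ := ε₁_thr(d, κ)/162, δ₀ = 1; all other letters 0.  A witness of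
consistency, NOT Bałaban's values. [cite: Balaban1988RG2Cluster, p.21 (after (2.39) and after (2.41))] -/
def c₀ (d : ℕ) : B13.Consts where
  L := 1
  q := 0
  M := 1
  κ := kappaThresholdL d 2
  κ₁ := 0
  δ := 1 / 20
  δ₀ := 1
  E₀ := 1
  ε₁ := eps1ThresholdL d (kappaThresholdL d 2) / 162
  C₁ := 1 / 2
  C₂ := 0
  C₃ := 0
  α₀ := 0
  α₁ := 0
  α₄ := 1
  α₅ := 0
  α₆ := 1
  γ₂ := 0
  γ := 0
  A₁ := 1
  A₂ := a2ThresholdL d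

/-- `K₀(c₀) = 1`. [folklore] -/
theorem c₀_K₀ (d : ℕ) : (c₀ d).K₀ = 1 := by
  simp [B13.Consts.K₀, c₀]

/-- `C₃(c₀) = 162`. [folklore] -/
theorem c₀_C3act (d : ℕ) : (c₀ d).C3act = 162 := by
  rw [B13.Consts.C3act, c₀_K₀]; simp [c₀]; norm_num

/-- `C₃ε₁ = ε₁_thr(d, κ)` exactly. [folklore] -/
theorem c₀_C3act_mul_eps1 (d : ℕ) : (c₀ d).C3act * (c₀ d).ε₁ = eps1ThresholdL d (c₀ d).κ := by
  rw [c₀_C3act]; simp [c₀]; ring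

/-- The closing relation `(1 − 10δ)ℓ = 1` at δ = 1/20, ℓ = 2. [cite: Balaban1988RG2Cluster, p.21 (after (2.41))] -/
theorem c₀_R22gen (d : ℕ) : (c₀ d).R22gen 2 := by
  show (1 - 10 * (1 / 20 : ℝ)) * 2 = 1
  norm_num

/-- The four k-free numeric conditions hold for `c₀ d` at ℓ = 2 (thresholds met with equality). [cite: Balaban1988RG2Cluster, p.21 (after (2.39))] -/
theorem c₀_condsL (d : ℕ) : CondsL d (c₀ d) 2 :=
  CondsL.of_thresholds (c₀ d) (c₀_R22gen d) (by norm_num) le_rfl le_rfl (c₀_C3act_mul_eps1 d).le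

/-- `C₃ε₁ > 0` for the witness: the activity constant is NOT degenerate. [folklore] -/
theorem c₀_activity_pos (d : ℕ) : 0 < (c₀ d).C3act * (c₀ d).ε₁ := by
  rw [c₀_C3act_mul_eps1]; exact eps1ThresholdL_pos d _

/-- The printed signs at α₂ = B₃ = 1. [folklore] -/
theorem c₀_signsL (d : ℕ) : SignsL (c₀ d) 1 1 :=
  ⟨(c₀_activity_pos d).le, one_pos, zero_le_one, by show (0 : ℝ) < 1; norm_num⟩

/-- **THE NUMERIC WITNESS**: the four conditions, the closing relation and the signs hold simultaneously, in every
dimension, with a non-zero activity constant. [cite: Balaban1988RG2Cluster, p.21 (after (2.39) and after (2.41))] -/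
theorem numeric_witness (d : ℕ) :
    CondsL d (c₀ d) 2 ∧ (c₀ d).R22gen 2 ∧ SignsL (c₀ d) 1 1 ∧ 0 < (c₀ d).C3act * (c₀ d).ε₁ :=
  ⟨c₀_condsL d, c₀_R22gen d, c₀_signsL d, c₀_activity_pos d⟩

/-- (190)-constants with B₃ = 1 valid at the rate δ₀ = 1: C = κ̄_B = c = m = 1, τ = θ = 1, σ = 0, δ₀^{[15]} = 8.
[folklore] -/
def q₀ : Consts190 where
  Cst := 1
  δ15 := 8
  σ := 0
  τ := 1
  cR := 1
  m := 1
  θ := 1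
  κB := 1

/-- `q₀` is valid at δ₀ = 1 = (c₀ d).δ₀. [folklore] -/
theorem q₀_valid : q₀.Valid 1 :=
  { Cst := zero_le_one, cR := zero_le_one, m := zero_le_one, κB := zero_le_one, τ := zero_le_one,
    στ := by show (0 : ℝ) + 1 ≤ 8 / 8; norm_num
    rate := by show (1 : ℝ) ≤ 1 * 1; norm_num }

/-- `B₃(q₀) = 1`. [folklore] -/
theorem q₀_B₃ : q₀.B₃ = 1 := by
  simp [Consts190.B₃, q₀]

/-! ## 2. The X-localized Kotecký–Preiss logarithm of the gas with ZERO activities vanishes -/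

section KP

variable {P : Type*} [DecidableEq P] (inc : P → P → Prop) [DecidableRel inc]

/-- Along the zero activity the ray derivative of the polymer partition function vanishes. [folklore] -/
theorem polymerRayDeriv_zero (Λ : Finset P) (t : ℝ) : polymerRayDeriv inc (fun _ => (0 : ℂ)) Λ t = 0 := by
  refine Finset.sum_eq_zero fun X _ => ?_
  rcases X.eq_empty_or_nonempty with h | ⟨γ, hγ⟩
  · simp [h]
  · rw [Finset.prod_eq_zero hγ rfl, mul_zero]

/-- Hence the Kotecký–Preiss logarithm of the gas with zero activities is 0. [folklore] -/
theorem polymerLogZ_zero (Λ : Finset P) : polymerLogZ inc (fun _ => (0 : ℂ)) Λ = 0 := by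
  simp [polymerLogZ, polymerRayDeriv_zero]

/-- … and every truncated functional Φ^T(C; 0) is 0. [folklore] -/
theorem truncatedWeight_zero (C : Finset P) : truncatedWeight inc (fun _ => (0 : ℂ)) C = 0 := by
  simp [truncatedWeight, polymerLogZ_zero]

end KP

/-- … so the X-localized part (2.13) of log Ξ with zero activities is 0. [folklore] -/
theorem locE_zero {Dom Cube : Type*} [DecidableEq Dom] [DecidableEq Cube] [Fintype Dom] (ι : Dom → Dom → Prop)
    [DecidableRel ι] (cubes : Dom → Finset Cube) (X : Finset Cube) : locE ι cubes (fun _ => (0 : ℂ)) X = 0 := by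
  simp [locE, truncatedWeight_zero]

/-! ## 3. The zero-activity torus step and the zero leaf list -/

/-- THE ZERO-ACTIVITY TORUS STEP on the torus with N cubes per direction: 𝐃_k := the torus system too, Φ := Unit, no
bond variables' values matter (Bond := Unit, B ≡ 0), all spaces = everything, all potentials / activities / actions 0,
all predicates True. [folklore] -/
def zeroStep (d N : ℕ) [NeZero N] : TorusStep d N where
  Dk := tsys d N
  volk := fun _ => 0
  Φ := Unit
  Bond := Unit
  sp1 := fun _ => Set.univ
  sp2 := fun _ => Set.univ
  Bv := fun _ _ => 0
  Vp := fun _ _ => 0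
  V := fun _ _ => 0
  Q := fun _ _ _ _ => 0
  Vpp := fun _ _ => 0
  H := fun _ _ => 0
  Ek1 := fun _ _ => 0
  Elog := fun _ _ => 0
  Analytic := fun _ _ => True
  GaugeInv := fun _ => True
  Repr17 := True
  Restr := True

variable {N : ℕ} [NeZero N]

/-- The restriction property p. 15 for the zero step (all spaces are everything). [folklore] -/
theorem zeroStep_spRestr (d N : ℕ) [NeZero N] : SpRestr (zeroStep d N).toStepData (zeroStep d N).geom :=
  TorusStep.spRestr _ fun _ _ _ _ _ => Set.mem_univ _

open Classical in
/-- The representation (2.13) for the zero step AT THE CONSTRUCTED TORUS GEOMETRY: 0 = the X-localized part of log Ξ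
of the gas with zero activities (`locE_zero`). [folklore] -/
theorem zeroStep_repr213 (d N : ℕ) [NeZero N] : Repr213 (zeroStep d N).toStepData (zeroStep d N).geom :=
  TorusStep.repr213 _ fun X _ _ => by
    show (0 : ℂ) = locE _ _ (fun _ => (0 : ℂ)) _
    rw [locE_zero]

/-- Lemma 3's (2.38)_ℓ for the zero step: `‖0‖ ≤ C₃ε₁e^{−…}` once `0 ≤ C₃ε₁`. [folklore] -/
theorem zeroStep_bound238With (d N : ℕ) [NeZero N] (c : B13.Consts) (ℓ : ℝ) (hA : 0 ≤ c.C3act * c.ε₁) :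
    B13.Bound238With (zeroStep d N).toStepData c ℓ := fun _ _ _ => by
  show ‖(0 : ℂ)‖ ≤ _
  rw [norm_zero]
  positivity

/-- The mixed second derivative (4.3) of the zero functional is 0. [folklore] -/
theorem mixedDeriv_zero {W : Type*} [NormedAddCommGroup W] [NormedSpace ℂ W] (a b : W) :
    mixedDeriv (fun _ : W => (0 : ℂ)) a b = 0 := by
  simp [mixedDeriv]

/-- The ONE-LOOP SPLIT WITNESS: β ≡ 1 = 1 + 0 — `β⁰ ≡ 1`, `β¹ ≡ 0` (vanishing at g_k = 0 trivially). [folklore] -/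
def splitZero : B12Beta.OneLoopSplit (fun _ _ => (1 : ℝ)) where
  β0 := fun _ => 1
  β1 := fun _ _ => 0
  split := fun _ _ => by simp
  vanish := fun _ _ _ => rfl

/-- The limit kernel of the zero family of localized terms is 0. [folklore] -/
theorem limKernel_zero (z : Pt d) : limKernel (fun (_ : LDom d) (_ : Pt d) => (0 : ℝ)) z = 0 := by
  simp [limKernel]

/-- The second moment (1.22) of the zero kernel is 0. [folklore] -/
theorem secondMoment_zero (μ ν : Fin d) : B12Beta.secondMoment (fun _ _ (_ : Fin d → ℤ) => (0 : ℝ)) μ ν = 0 := by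
  simp [B12Beta.secondMoment]

/-- **THE ZERO LEAF LIST** — an inhabitant of `RemainderLocality.PolLeavesTFac d M 0 c ℓ α₂ B₃` for ANY constants with
`0 ≤ C₃ε₁` and `0 ≤ B₃`: exhausting tori N_n = n + 1, the zero-activity torus steps, test-vector spaces `ℂ` with
everything 0, restricted-configuration spaces `ℂ` with F = 0, r = 0, t = 0.  Every field is a closed term.
[cite: Balaban1987RG1, (4.35) p.290 and (5.1) p.292; Balaban1988RG2Cluster, (2.38) p.20] -/
def zeroLeaves (d M : ℕ) [NeZero M] (c : B13.Consts) (ℓ α₂ B₃ : ℝ) (hA : 0 ≤ c.C3act * c.ε₁) (hB : 0 ≤ B₃) :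
    PolLeavesTFac d M (fun _ _ => 0) c ℓ α₂ B₃ where
  N := fun n => n + 1
  hNlim := tendsto_add_atTop_nat 1
  W := fun n => zeroStep d (n + 1)
  hsp := fun n => zeroStep_spRestr d (n + 1)
  hrep := fun n => zeroStep_repr213 d (n + 1)
  h238 := fun n => zeroStep_bound238With d (n + 1) c ℓ hA
  Wn := fun _ => ℂ
  EXn := fun _ _ _ => 0
  emb := fun _ _ _ => ()
  hemb := fun _ _ _ _ => Set.mem_univ _
  hcomp := fun _ _ _ => rfl
  hn := fun _ _ _ => 0
  E2n := fun _ _ _ _ => 0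
  han := fun _ _ => analyticOnNhd_const
  hrepr := fun _ _ _ _ => by rw [mixedDeriv_zero]; simp
  hh := fun _ _ _ => by rw [norm_zero]; positivity
  V := fun _ => ℂ
  F := fun _ _ => 0
  hF := fun _ => analyticAt_const
  r := fun _ _ => 0
  hfac := fun _ => Eventually.of_forall fun _ _ _ => by simp
  t := fun _ _ => 0
  hconv := fun _ _ => by simp
  ha := fun _ _ => by rw [mixedDeriv_zero]; simp

/-- **THE ZERO CHAIN** — an inhabitant of `RemainderLocality.ChainTFac d M μ ν splitZero γ c ℓ α₂ B₃` (localized terms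
A ≡ 0, so Π = limKernel 0 = 0 and β¹ ≡ 0 = its second moment). [cite: Balaban1987RG1, (1.22) p.264 and (5.1) p.292] -/
def zeroChain (d M : ℕ) [NeZero M] (μ ν : Fin d) (γ : ℝ) (c : B13.Consts) (ℓ α₂ B₃ : ℝ) (hA : 0 ≤ c.C3act * c.ε₁)
    (hB : 0 ≤ B₃) : ChainTFac d M μ ν splitZero γ c ℓ α₂ B₃ where
  A1 := fun _ _ _ _ => 0
  beta1_eq := fun _ _ _ => by
    show (0 : ℝ) = B12Beta.secondMoment (fun _ _ => limKernel (fun (_ : LDom d) (_ : Pt d) => (0 : ℝ))) μ ν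
    simp [B12Beta.secondMoment, limKernel]
  leaves := fun _ _ _ => zeroLeaves d M c ℓ α₂ B₃ hA hB


/-! ## 3b. The (190)-layer: a one-site multiscale geometry, the absolute value as block norm, ZERO source fields -/

/-- A ONE-SITE multiscale geometry (𝔅 = {pt}, d ≡ 0, all vocabulary trivial). [folklore] -/
def oneSite : B6.Geometry where
  Site := Unit
  fin := inferInstance
  scale := fun _ => 0
  dist := fun _ _ => 0
  k := 0
  eta := 0
  L := 0
  R := 0
  M := 0
  Hyp21_22 := True
  Loc := Unit
  suppIn := fun _ _ => True
  supNorm := fun _ => 0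
  l2Norm := fun _ => 0
  holder := fun _ _ => 0
  Cut := Unit
  cutIn := fun _ _ => True
  cutH := fun _ _ => 0
  cutSup := fun _ => 0

/-- The absolute value on `ℝ` as a block-normed space over the one-site geometry (cut = identity, κ = 1). [folklore] -/
def absNorm : BlockNorm oneSite ℝ where
  loc := fun _ f => |f|
  cut := fun _ => LinearMap.id
  IsLoc := fun _ _ => True
  κ := 1
  κ_nonneg := zero_le_one
  loc_nonneg := fun _ f => abs_nonneg f
  loc_zero := fun _ => abs_zero
  loc_add_le := fun _ f f' => abs_add_le f f'
  loc_neg := fun _ f => abs_neg f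
  sum_cut := fun f => by
    show ∑ _y : Unit, (LinearMap.id : ℝ →ₗ[ℝ] ℝ) f = f
    simp
  isLoc_cut := fun _ _ => trivial
  loc_cut_le := fun _ f => by simp

/-- **THE ZERO (190)-SIDE DATA** on the tori (any N, test-vector spaces `ℂ`): one-site geometries, `|·|` as B-size and
local size, first B-derivative 0, no blocks meeting anything, identification 0, unit source fields 0 (so the
localisation clause `UnitFieldsLocalised` holds VACUOUSLY: `|0| ≠ 0` is false), (190) with majorant `1·e^{−0}`, row sum
`1 ≤ 1`, cutting constant `1 ≤ 1`, domination `‖0‖ ≤ t`. [folklore] -/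
def zeroData190 (d M : ℕ) [NeZero M] (N : ℕ → ℕ) [∀ n, NeZero (N n)] : Data190 d M N (fun _ => ℂ) q₀ where
  I := Unit
  gn := fun _ => oneSite
  FBn := fun _ => ℝ
  FAn := fun _ => ℝ
  bBn := fun _ => absNorm
  boutn := fun _ _ => absNorm
  dHn := fun _ => 0
  blkn := fun _ _ => ∅
  ιn := fun _ _ _ => 0
  un := fun _ _ => 0
  h190 := fun _ _ _ μ _ _ => by
    show |((0 : ℝ →ₗ[ℝ] ℝ) μ)| ≤ (1 : ℝ) * Real.exp (-((8 : ℝ) / 8 * 0)) * |μ|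
    simp
  hdist := fun _ _ _ => le_rfl
  hrow := fun _ _ => by
    show ∑ _y' : Unit, Real.exp (-((0 : ℝ) * 0)) ≤ (1 : ℝ)
    simp
  hκB := fun _ => le_rfl
  hdom := fun _ _ _ t ht _ => by
    show ‖(0 : ℂ)‖ ≤ t
    rwa [norm_zero]
  hm := fun _ _ _ => by
    show |(0 : ℝ)| ≤ (1 : ℝ)
    simp
  hD := fun _ _ _ _ _ _ h => absurd (abs_zero : |(0 : ℝ)| = 0) h

/-- The test vectors generated by the zero data are 0. [folklore] -/
theorem zeroData190_hn (d M : ℕ) [NeZero M] (N : ℕ → ℕ) [∀ n, NeZero (N n)] (n : ℕ) (X : TDom d (N n))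
    (x : TPt d (N n * M)) : (zeroData190 d M N).hn n X x = 0 := rfl

/-- **THE ZERO LEAF LIST WITH THE (190)-LAYER** — an inhabitant of `RemainderDecay190.PolLeavesTFac190 d M 0 c ℓ α₂ q₀`
for ANY constants with `0 ≤ C₃ε₁`. [cite: Balaban1985Variational, (190) p.308; Balaban1987RG1, (4.35) p.290] -/
def zeroLeaves190 (d M : ℕ) [NeZero M] (c : B13.Consts) (ℓ α₂ : ℝ) (hA : 0 ≤ c.C3act * c.ε₁) :
    PolLeavesTFac190 d M (fun _ _ => 0) c ℓ α₂ q₀ where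
  N := fun n => n + 1
  hNlim := tendsto_add_atTop_nat 1
  W := fun n => zeroStep d (n + 1)
  hsp := fun n => zeroStep_spRestr d (n + 1)
  hrep := fun n => zeroStep_repr213 d (n + 1)
  h238 := fun n => zeroStep_bound238With d (n + 1) c ℓ hA
  Wn := fun _ => ℂ
  EXn := fun _ _ _ => 0
  emb := fun _ _ _ => ()
  hemb := fun _ _ _ _ => Set.mem_univ _
  hcomp := fun _ _ _ => rfl
  D := zeroData190 d M (fun n => n + 1)
  E2n := fun _ _ _ _ => 0
  han := fun _ _ => analyticOnNhd_const
  hrepr := fun _ _ _ _ => by rw [mixedDeriv_zero]; simp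
  V := fun _ => ℂ
  F := fun _ _ => 0
  hF := fun _ => analyticAt_const
  r := fun _ _ => 0
  hfac := fun _ => Eventually.of_forall fun _ _ _ => by simp
  t := fun _ _ => 0
  hconv := fun _ _ => by simp
  ha := fun _ _ => by rw [mixedDeriv_zero]; simp

/-- **THE ZERO CHAIN WITH THE (190)-LAYER** — an inhabitant of `RemainderDecay190.ChainTFac190 d M μ ν splitZero γ c ℓ α₂ q₀`.
[folklore] -/
def zeroChain190 (d M : ℕ) [NeZero M] (μ ν : Fin d) (γ : ℝ) (c : B13.Consts) (ℓ α₂ : ℝ)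
    (hA : 0 ≤ c.C3act * c.ε₁) : ChainTFac190 d M μ ν splitZero γ c ℓ α₂ q₀ where
  A1 := fun _ _ _ _ => 0
  beta1_eq := fun _ _ _ => by
    show (0 : ℝ) = B12Beta.secondMoment (fun _ _ => limKernel (fun (_ : LDom d) (_ : Pt d) => (0 : ℝ))) μ ν
    simp [B12Beta.secondMoment, limKernel]
  leaves := fun _ _ _ => zeroLeaves190 d M c ℓ α₂ hA

/-! ## 4. The binder lists are inhabited -/

/-- **EVERY BINDER OF THE an4 END IS INHABITED SIMULTANEOUSLY** (d ≥ 1, any M ≥ 1, any μ, ν, γ): a chain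
`ChainTFac d M μ ν S γ c ℓ α₂ B₃` together with `CondsL d c ℓ`, `c.R22gen ℓ`, `SignsL c α₂ B₃` — at c := c₀ d, ℓ := 2,
α₂ = B₃ = 1, S := splitZero. [folklore] -/
theorem binders_inhabited (d M : ℕ) [NeZero M] (μ ν : Fin d) (γ : ℝ) :
    Nonempty (ChainTFac d M μ ν splitZero γ (c₀ d) 2 1 1) ∧ CondsL d (c₀ d) 2 ∧ (c₀ d).R22gen 2 ∧ SignsL (c₀ d) 1 1 :=
  ⟨⟨zeroChain d M μ ν γ (c₀ d) 2 1 1 (c₀_activity_pos d).le zero_le_one⟩, c₀_condsL d, c₀_R22gen d, c₀_signsL d⟩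

/-- The same for the intermediate lists: `ChainTLoc` (`RemainderLimitTorus`) and `ChainT` (`RemainderChainTorus`) are
inhabited at the same constants, via the tree's maps. [folklore] -/
theorem binders_inhabited_loc_torus (d M : ℕ) [NeZero M] (μ ν : Fin d) (γ : ℝ) :
    Nonempty (ChainTLoc d M μ ν splitZero γ (c₀ d) 2 1 1) ∧ Nonempty (ChainT d M μ ν splitZero γ (c₀ d) 2 1 1) :=
  let R := zeroChain d M μ ν γ (c₀ d) 2 1 1 (c₀_activity_pos d).le zero_le_one
  ⟨⟨R.toChainTLoc one_pos⟩, ⟨(R.toChainTLoc one_pos).toChainT (c₀_condsL d) (c₀_R22gen d) (c₀_signsL d)⟩⟩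


/-- `q₀` is valid at the witness's δ₀ (= 1). [folklore] -/
theorem q₀_valid_c₀ (d : ℕ) : q₀.Valid (c₀ d).δ₀ := q₀_valid

/-- **EVERY BINDER OF THE CURRENT an4 END (`RemainderDecay190.ChainTFac190.abs_beta1_le`) IS INHABITED SIMULTANEOUSLY**:
a chain with the (190)-layer at q₀, `CondsL`, the closing relation, `q₀.Valid δ₀` and the signs at B₃ := B₃(q₀) = 1.
[folklore] -/
theorem binders_inhabited_190 (d M : ℕ) [NeZero M] (μ ν : Fin d) (γ : ℝ) :
    Nonempty (ChainTFac190 d M μ ν splitZero γ (c₀ d) 2 1 q₀) ∧ CondsL d (c₀ d) 2 ∧ (c₀ d).R22gen 2 ∧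
      q₀.Valid (c₀ d).δ₀ ∧ SignsL (c₀ d) 1 q₀.B₃ :=
  ⟨⟨zeroChain190 d M μ ν γ (c₀ d) 2 1 (c₀_activity_pos d).le⟩, c₀_condsL d, c₀_R22gen d, q₀_valid_c₀ d,
    (q₀_valid_c₀ d).signsL (c₀_activity_pos d).le one_pos (by show (0 : ℝ) < 1; norm_num)⟩

/-! ## 5. The END theorems APPLIED to the witness (every argument a closed term) -/

/-- **THE an4 END, APPLIED**: `RemainderLocality.ChainTFac.abs_beta1_le` at the witness (d ≥ 1) — its conclusion
`RemainderConst splitZero γ (ε₁ · K_rem,L(d, M, c₀ d, 1, 1))` obtained BY NAME, so the theorem is not vacuous. [folklore] -/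
theorem endTFac_applied (d M : ℕ) [NeZero M] (hd : 0 < d) (μ ν : Fin d) (γ : ℝ) :
    RemainderConst splitZero γ ((c₀ d).ε₁ * remCoeffL d M (c₀ d) 1 1) :=
  (zeroChain d M μ ν γ (c₀ d) 2 1 1 (c₀_activity_pos d).le zero_le_one).abs_beta1_le
    (c₀_condsL d) (c₀_R22gen d) (c₀_signsL d) hd

/-- The torus END `RemainderChainTorus.ChainT.abs_beta1_le` applied likewise. [folklore] -/
theorem endT_applied (d M : ℕ) [NeZero M] (hd : 0 < d) (μ ν : Fin d) (γ : ℝ) :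
    RemainderConst splitZero γ ((c₀ d).ε₁ * remCoeffL d M (c₀ d) 1 1) :=
  (((zeroChain d M μ ν γ (c₀ d) 2 1 1 (c₀_activity_pos d).le zero_le_one).toChainTLoc one_pos).toChainT
    (c₀_condsL d) (c₀_R22gen d) (c₀_signsL d)).abs_beta1_le (c₀_condsL d) (c₀_R22gen d) (c₀_signsL d) hd


/-- **THE CURRENT an4 END, APPLIED**: `RemainderDecay190.ChainTFac190.abs_beta1_le` at the witness with the (190)-layer
(d ≥ 1) — conclusion `RemainderConst splitZero γ (ε₁ · K_rem,L(d, M, c₀ d, 1, B₃(q₀)))` obtained BY NAME. [folklore] -/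
theorem end190_applied (d M : ℕ) [NeZero M] (hd : 0 < d) (μ ν : Fin d) (γ : ℝ) :
    RemainderConst splitZero γ ((c₀ d).ε₁ * remCoeffL d M (c₀ d) 1 q₀.B₃) :=
  (zeroChain190 d M μ ν γ (c₀ d) 2 1 (c₀_activity_pos d).le).abs_beta1_le (c₀_condsL d) (c₀_R22gen d)
    (q₀_valid_c₀ d) ((q₀_valid_c₀ d).signsL (c₀_activity_pos d).le one_pos (by show (0 : ℝ) < 1; norm_num)) hd

/-- d = 4, M = 3 (any direction pair, any γ): the physical dimension's binder list is inhabited. [folklore] -/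
example (μ ν : Fin 4) (γ : ℝ) : RemainderConst splitZero γ ((c₀ 4).ε₁ * remCoeffL 4 3 (c₀ 4) 1 1) :=
  endTFac_applied 4 3 (by norm_num) μ ν γ

/-- Sanity: the witness's remainder coefficient is the chain's closed formula at explicit letters, and the bound it
delivers on β¹ ≡ 0 is of course also immediate (`abs_zero`); the content of §5 is that the END's ARGUMENTS exist. [folklore] -/
example (γ : ℝ) (r : ℝ) (hr : 0 ≤ r) : RemainderConst splitZero γ r := fun _ _ _ => by
  show |(0 : ℝ)| ≤ r
  rwa [abs_zero]


/-! ## 6. (v1.1) The wall-side (R10) ENDs APPLIED: telescoping against a CONSTANT one-loop sequence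

The (R10) consumers `RemainderDecay190.betaPartialSumsLowerH_of_telescope_chainTFac190` /
`endpointExistence_of_telescope_chainTFac190` add FLOW-SIDE binders to the chain's: a forward-generated construction
`C` (`ForwardGenerated C β`), telescoping `∑_{j<k} β⁰_j = B(L^k)` against a comparison function with
`|B n − b·log n| ≤ A` (n ≥ 2), the budget `ε₁·K_rem,L ≤ b·log L`, `0 ≤ β'`, continuity `BetaContH γ₀ β` and the upper
bound `BetaUpperH β' γ₀ β`.  They are inhabited jointly with §§1–3b by the CONSTANT split β ≡ β⁰ ≡ λ, β¹ ≡ 0 with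
λ := ε₁·K_rem,L(d, M, c₀ d, 1, B₃(q₀)) ITSELF (so the budget holds with equality: B n := λ·log n / log L, b := λ / log L,
A := 0), γ₀ := 1, β' := |λ|, and the lead lineage's canonical construction `FlowStepRuns.modelOf β`
(`modelOf_forwardGenerated`; the same construction the β lead's wall witness uses).  Zero content about Bałaban's flow:
the conclusion `EndpointExistence (modelOf β)` is OBTAINED FROM THE (R10) END with every argument a closed term. -/

section Wall

open Literature.MathematicalPhysics.QuantumFieldTheory.Balaban1983to89.DagBinding (EndpointExistence ForwardGenerated)
open Literature.MathematicalPhysics.QuantumFieldTheory.Balaban1983to89.FlowStepRuns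
  (modelOf modelOf_forwardGenerated BetaPartialSumsLowerH)
open Literature.MathematicalPhysics.QuantumFieldTheory.Balaban1983to89.Beta.RemainderDecay190
  (betaPartialSumsLowerH_of_telescope_chainTFac190 endpointExistence_of_telescope_chainTFac190)

/-- The CONSTANT split: β ≡ β⁰ ≡ λ, β¹ ≡ 0. [folklore] -/
def splitConst (lam : ℝ) : B12Beta.OneLoopSplit (fun _ _ => lam) where
  β0 := fun _ => lam
  β1 := fun _ _ => 0
  split := fun _ _ => by simp
  vanish := fun _ _ _ => rfl

/-- The zero chain with the (190)-layer under the constant split (β¹ ≡ 0 = the second moment of the zero kernel).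
[folklore] -/
def constChain190 (d M : ℕ) [NeZero M] (μ ν : Fin d) (lam γ : ℝ) (c : B13.Consts) (ℓ α₂ : ℝ)
    (hA : 0 ≤ c.C3act * c.ε₁) : ChainTFac190 d M μ ν (splitConst lam) γ c ℓ α₂ q₀ where
  A1 := fun _ _ _ _ => 0
  beta1_eq := fun _ _ _ => by
    show (0 : ℝ) = B12Beta.secondMoment (fun _ _ => limKernel (fun (_ : LDom d) (_ : Pt d) => (0 : ℝ))) μ ν
    simp [B12Beta.secondMoment, limKernel]
  leaves := fun _ _ _ => zeroLeaves190 d M c ℓ α₂ hA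

/-- The remainder value the current END delivers at the witness: λ(d, M) := ε₁·K_rem,L(d, M, c₀ d, 1, B₃(q₀)).  The
(R10) END's budget binder reads `c.ε₁ * remCoeffL d M c α₂ q.B₃ ≤ b * Real.log L`; at `c := c₀ d`, `α₂ := 1`, `q := q₀`
its left-hand side IS this term (δ-unfolding), which is how `budget_const (lamW d M)` fills it in `wallEnd_applied`. [folklore] -/
def lamW (d M : ℕ) : ℝ := (c₀ d).ε₁ * remCoeffL d M (c₀ d) 1 q₀.B₃

example (d M : ℕ) : (c₀ d).ε₁ * remCoeffL d M (c₀ d) 1 q₀.B₃ = lamW d M := rfl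

/-- The comparison function B n := λ·log n / log L. [folklore] -/
def BW (lam : ℝ) (L : ℕ) (n : ℕ) : ℝ := lam * Real.log n / Real.log L

/-- Telescoping: `∑_{j<k} λ = B(L^k)` for `L ≥ 2`. [folklore] -/
theorem telescope_const (lam : ℝ) {L : ℕ} (hL : 2 ≤ L) (k : ℕ) :
    ∑ j ∈ Finset.range k, (splitConst lam).β0 j = BW lam L (L ^ k) := by
  have hlog : Real.log (L : ℝ) ≠ 0 := (Real.log_pos (by exact_mod_cast hL)).ne'
  simp only [splitConst, Finset.sum_const, Finset.card_range, nsmul_eq_mul, BW, Nat.cast_pow, Real.log_pow]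
  rw [← mul_assoc, mul_div_assoc, div_self hlog, mul_one, mul_comm]

/-- The comparison function is EXACTLY b·log n with b := λ / log L (so A := 0). [folklore] -/
theorem BW_sub (lam : ℝ) (L : ℕ) (n : ℕ) (_hn : 2 ≤ n) :
    |BW lam L n - lam / Real.log L * Real.log n| ≤ 0 := by
  rw [show BW lam L n - lam / Real.log L * Real.log n = 0 by unfold BW; ring, abs_zero]

/-- The budget with equality: `λ ≤ (λ / log L)·log L`. [folklore] -/
theorem budget_const (lam : ℝ) {L : ℕ} (hL : 2 ≤ L) : lam ≤ lam / Real.log L * Real.log (L : ℝ) := by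
  have hlog : Real.log (L : ℝ) ≠ 0 := (Real.log_pos (by exact_mod_cast hL)).ne'
  rw [div_mul_cancel₀ lam hlog]

/-- **EVERY BINDER OF THE (R10) ENDs IS INHABITED SIMULTANEOUSLY** (chain side from §§1–3b at λ := λ(d, M); flow side:
`modelOf`, telescoping against `BW`, A := 0, budget with equality, γ₀ := 1, β' := |λ|, constant continuity, `λ ≤ |λ|`).
[folklore] -/
theorem wall_binders_inhabited (d M : ℕ) [NeZero M] (μ ν : Fin d) {L : ℕ} (hL : 2 ≤ L) :
    ForwardGenerated (modelOf fun _ _ => lamW d M) (fun _ _ => lamW d M) ∧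
    Nonempty (ChainTFac190 d M μ ν (splitConst (lamW d M)) 1 (c₀ d) 2 1 q₀) ∧ CondsL d (c₀ d) 2 ∧ (c₀ d).R22gen 2 ∧
    q₀.Valid (c₀ d).δ₀ ∧ SignsL (c₀ d) 1 q₀.B₃ ∧
    (∀ k : ℕ, ∑ j ∈ Finset.range k, (splitConst (lamW d M)).β0 j = BW (lamW d M) L (L ^ k)) ∧
    (∀ n : ℕ, 2 ≤ n → |BW (lamW d M) L n - lamW d M / Real.log L * Real.log n| ≤ 0) ∧
    (c₀ d).ε₁ * remCoeffL d M (c₀ d) 1 q₀.B₃ ≤ lamW d M / Real.log L * Real.log L ∧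
    BetaContH 1 (fun _ _ => lamW d M) ∧ BetaUpperH |lamW d M| 1 (fun _ _ => lamW d M) :=
  ⟨modelOf_forwardGenerated _, ⟨constChain190 d M μ ν (lamW d M) 1 (c₀ d) 2 1 (c₀_activity_pos d).le⟩, c₀_condsL d,
    c₀_R22gen d, q₀_valid_c₀ d,
    (q₀_valid_c₀ d).signsL (c₀_activity_pos d).le one_pos (by show (0 : ℝ) < 1; norm_num), telescope_const _ hL,
    BW_sub _ L, budget_const _ hL, fun _ => continuousOn_const, fun _ _ _ => le_abs_self _⟩

/-- **THE (R10) PARTIAL-SUMS END, APPLIED**: `betaPartialSumsLowerH_of_telescope_chainTFac190` at the witness —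
conclusion `BetaPartialSumsLowerH (2·0) 1 (β ≡ λ)` obtained BY NAME (d ≥ 1, any M ≥ 1, μ, ν, L ≥ 2). [folklore] -/
theorem wallSums_applied (d M : ℕ) [NeZero M] (hd : 0 < d) (μ ν : Fin d) {L : ℕ} (hL : 2 ≤ L) :
    BetaPartialSumsLowerH (2 * 0) 1 (fun _ _ => lamW d M) :=
  betaPartialSumsLowerH_of_telescope_chainTFac190 (constChain190 d M μ ν (lamW d M) 1 (c₀ d) 2 1 (c₀_activity_pos d).le)
    (c₀_condsL d) (c₀_R22gen d) (q₀_valid_c₀ d)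
    ((q₀_valid_c₀ d).signsL (c₀_activity_pos d).le one_pos (by show (0 : ℝ) < 1; norm_num)) hd hL le_rfl
    (telescope_const _ hL) (BW_sub _ L) (budget_const _ hL)

/-- **THE (R10) ENDPOINT-EXISTENCE END, APPLIED**: `endpointExistence_of_telescope_chainTFac190` at the witness —
conclusion `EndpointExistence (modelOf (β ≡ λ(d, M)))` obtained BY NAME (d ≥ 1, any M ≥ 1, μ, ν, L ≥ 2). [folklore] -/
theorem wallEnd_applied (d M : ℕ) [NeZero M] (hd : 0 < d) (μ ν : Fin d) {L : ℕ} (hL : 2 ≤ L) :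
    EndpointExistence (modelOf fun _ _ => lamW d M) :=
  endpointExistence_of_telescope_chainTFac190 (modelOf_forwardGenerated _)
    (constChain190 d M μ ν (lamW d M) 1 (c₀ d) 2 1 (c₀_activity_pos d).le) (c₀_condsL d) (c₀_R22gen d)
    (q₀_valid_c₀ d) ((q₀_valid_c₀ d).signsL (c₀_activity_pos d).le one_pos (by show (0 : ℝ) < 1; norm_num)) hd
    one_pos hL le_rfl (telescope_const _ hL) (BW_sub _ L) (budget_const _ hL) (abs_nonneg _)
    (fun _ => continuousOn_const) (fun _ _ _ => le_abs_self _)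

/-- d = 4, M = 3, L = 2: the (R10) END applies at the physical dimension. [folklore] -/
example : EndpointExistence (modelOf fun _ _ => lamW 4 3) :=
  wallEnd_applied 4 3 (by norm_num) 0 1 (L := 2) le_rfl

end Wall

end


end Literature.MathematicalPhysics.QuantumFieldTheory.Balaban1983to89.Beta.RemainderWitness
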